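import Mathlib.GroupTheory.Commutator.Basic
import Mathlib.LinearAlgebra.FreeModule.ModN
import Literature.AlgebraicTopology.FundamentalGroup.TopologicalGroupCovering
import HarnessLib

/-!
# `|H₁(G; ℤ)/n| = |Ker (x ↦ xⁿ)|` for a compact commutative group: Hurewicz transport

Topic `Literature/AlgebraicTopology/FundamentalGroup`; a short complement to
`TopologicalGroupCovering.lean` (Eckmann–Hilton in `π₁(G, 1)`, the covering `x ↦ xⁿ`,
`[π₁(G, 1) : {γⁿ}] = |Ker (x ↦ xⁿ)|`). Everything here is PROVED; no named fact is introduced.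
Written for the fact seat of
`Literature.AlgebraicGeometry.Motives.two_mul_dim_eq_finrank_bettiCohomology` (Mumford, *Abelian
Varieties*, §1 (3): for `X = A(ℂ) = V/U`, `H₁(X, ℤ) = π₁(X) = U` and `X[n] = n⁻¹U/U`, so
`|H₁(X, ℤ)/n| = |X[n]| = n^{2g}`; here read backwards, from the group `A(ℂ)` and `|A[n](ℂ)|`).

* `FundamentalGroup.commutator_eq_bot_of_topologicalGroup`,
  `nonempty_fundamentalGroup_mulEquiv_singularHomology_one` — **`π₁(G, 1) ≅ H₁(G; ℤ)`** for a
  path-connected topological group: the Hurewicz homomorphism (Hatcher Thm. 2A.1, the tree's PROVED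
  `singularHomology.hurewicz_one_holds`: onto, kernel the commutator subgroup) is injective because
  `π₁(G, 1)` is commutative (`isMulCommutative_fundamentalGroup_one`).
* `map_range_mapOfEq_powMap` — under any isomorphism `π₁(G, 1) ≅ M` the `n`-th powers go to `nM`.
* `natCard_modN_eq_natCard_ker_pow` — **`|M/nM| = |Ker (x ↦ xⁿ)|`** for `M ≅ π₁(G, 1)` (e.g.
  `M = H₁(G; ℤ)`), `G` compact Hausdorff path-connected commutative with `x ↦ xⁿ` onto with finite
  kernel (`index_range_powMonoidHom_fundamentalGroup`).

## References

* A. Hatcher, *Algebraic Topology*, CUP 2002: §1.3 Prop. 1.39, Thm. 2A.1 (p. 166), §3.C Ex. 5.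
  [HatcherAT2002]
* D. Mumford, *Abelian Varieties* (1970), §1 (3). [MumfordAV1970]
-/

noncomputable section

open Function Topology

universe u v

namespace Literature.AlgebraicTopology.FundamentalGroup

open Literature.AlgebraicTopology.SingularHomology

section HOne

variable {G : Type u} [TopologicalSpace G] [Group G] [IsTopologicalGroup G]

/-- The commutator subgroup of `π₁(G, 1)` is trivial: the fundamental group of a topological
group is commutative (Eckmann–Hilton, `isMulCommutative_fundamentalGroup_one`).
[cite: HatcherAT2002, §3.C Ex. 5 (p. 291)] -/
theorem _root_.FundamentalGroup.commutator_eq_bot_of_topologicalGroup :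
    commutator (FundamentalGroup G (1 : G)) = ⊥ := by
  rw [commutator_def, Subgroup.commutator_eq_bot_iff_le_centralizer]
  intro x _
  rw [Subgroup.mem_centralizer_iff]
  intro y _
  exact (isMulCommutative_fundamentalGroup_one (G := G)).is_comm.comm y x

/-- **Hurewicz for a topological group: `π₁(G, 1) ≅ H₁(G; ℤ)`.** The Hurewicz homomorphism
`π₁(G, 1) → H₁(G; ℤ)` (Hatcher Thm. 2A.1, the tree's PROVED `singularHomology.hurewicz_one_holds`:
onto for `G` path connected, kernel the commutator subgroup) is an isomorphism, `π₁(G, 1)` being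
commutative. [cite: HatcherAT2002, Thm. 2A.1 (p. 166) and §3.C Ex. 5] -/
theorem nonempty_fundamentalGroup_mulEquiv_singularHomology_one [PathConnectedSpace G] :
    Nonempty (FundamentalGroup G (1 : G) ≃* Multiplicative (singularHomology ℤ ℤ G 1)) := by
  obtain ⟨h, hsurj, hker⟩ := singularHomology.hurewicz_one_holds G (1 : G)
  rw [FundamentalGroup.commutator_eq_bot_of_topologicalGroup] at hker
  exact ⟨MulEquiv.ofBijective h ⟨(MonoidHom.ker_eq_bot_iff h).mp hker, hsurj⟩⟩

/-- Under an isomorphism `π₁(G, 1) ≅ M` with an abelian group `M` (written multiplicatively;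
e.g. Hurewicz, `M = H₁(G; ℤ)`), the subgroup of `n`-th powers of `π₁(G, 1)` — the image of
`(x ↦ xⁿ)_*`, `mapOfEq_powMap` — goes to `nM`. [folklore] -/
theorem map_range_mapOfEq_powMap {M : Type v} [AddCommGroup M]
    (e : FundamentalGroup G (1 : G) ≃* Multiplicative M) (n : ℕ) :
    Subgroup.map e.toMonoidHom (FundamentalGroup.mapOfEq (powMap G n) (powMap_one n)).range =
      AddSubgroup.toSubgroup (LinearMap.range (LinearMap.lsmul ℤ M n)).toAddSubgroup := by
  ext y
  simp only [Subgroup.mem_map, MonoidHom.mem_range, MulEquiv.coe_toMonoidHom,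
    exists_exists_eq_and, mapOfEq_powMap, map_pow, Multiplicative.mem_toSubgroup,
    Submodule.mem_toAddSubgroup, LinearMap.mem_range, LinearMap.lsmul_apply]
  constructor
  · rintro ⟨a, rfl⟩
    exact ⟨(e a).toAdd, by rw [natCast_zsmul, ← toAdd_pow]⟩
  · rintro ⟨x, hx⟩
    refine ⟨e.symm (Multiplicative.ofAdd x), ?_⟩
    rw [MulEquiv.apply_symm_apply, ← ofAdd_nsmul, ← natCast_zsmul, hx, ofAdd_toAdd]

/-- **`|M / nM| = |Ker (x ↦ xⁿ)|` for `M ≅ π₁(G, 1)`**, `G` a compact Hausdorff path-connected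
commutative topological group in which `x ↦ xⁿ` is onto with finite kernel `K`, and `M` any
abelian group isomorphic to `π₁(G, 1)` (e.g. `M = H₁(G; ℤ)` by Hurewicz,
`nonempty_fundamentalGroup_mulEquiv_singularHomology_one`): the `n`-th powers in `π₁(G, 1)` have
index `|K|` (`index_range_powMonoidHom_fundamentalGroup`, the covering `x ↦ xⁿ`) and correspond to
`nM`. For `G = A(ℂ)`, a complex abelian variety: `|H₁(A(ℂ); ℤ)/n| = |A[n](ℂ)| = n^{2g}` (Mumford
§1 (3): `H₁(X, ℤ) ≅ U`, `X[n] = n⁻¹U/U`). [cite: MumfordAV1970, §1 (3)] [cite: HatcherAT2002, §1.3 Prop. 1.39 and Thm. 2A.1] -/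
theorem natCard_modN_eq_natCard_ker_pow {G : Type u} [TopologicalSpace G]
    [CommGroup G] [IsTopologicalGroup G] [CompactSpace G] [T2Space G] [PathConnectedSpace G]
    {M : Type v} [AddCommGroup M] (e : FundamentalGroup G (1 : G) ≃* Multiplicative M)
    (n : ℕ) (hs : Surjective fun x : G ↦ x ^ n)
    (hf : ((powMonoidHom n : G →* G).ker : Set G).Finite) :
    Nat.card (ModN M n) = Nat.card (powMonoidHom n : G →* G).ker := by
  rw [← index_range_powMonoidHom_fundamentalGroup n hs hf,
    ← Subgroup.index_map_of_bijective (f := e.toMonoidHom) e.bijective, map_range_mapOfEq_powMap e n,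
    AddSubgroup.index_toSubgroup]
  rfl

end HOne

end Literature.AlgebraicTopology.FundamentalGroup

end
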